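/-
Origin: expansion seat `prover-pub-hodgecm-mc-binder-1-g17-0`, handover #R118r2 2026-08-20T22:31:33Z md5 78762d18d6f0 (234 l.; REPLACE of HodgeCM/Model/TowerFixed.lean — PKG file now bf02c85ac97f (238 l., incl. packager Origin header); body of record eccb33f81947 (234 l.) → 78762d18d6f0; owner binder-1 #R118 (RUN 64); token strike + one call site (trPull_one_injective lost its hle argument); NAMES for audit: HodgeCM.Model.TowerCarrier.fixedBy_eq_levelImage · HodgeCM.Model.TowerCarrier.mem_levelImage_iff · HodgeCM.Level.finiteIndex_subgroupOf_K) (`HOME/mc/pub-hodgecm-mc-binder-1-g17/campaign/new/TowerFixed.lean`, md5 78762d18d6f0, 234 lines);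
landed by the gen-27 packager (p-g27) in gate run 65 REPLACES the earlier landed copy of `HodgeCM/Model/TowerFixed.lean` (verbatim).
-/
/-
Copyright (c) 2026 the pub-hodgecm formalisation cell (harness21).  New file, not vendored.
Origin: session prover-pub-hodgecm-mc-binder-1-g16-0 (unit pub-hodgecm-mc-binder-1-g16, BINDER PROVER gen 16 of lineage mc-binder-1;
content lane (J-Liu-Θ), (J3) HECKE-TOWER sub-leaf (T4)-strong, part 2: the `K`-fixed vectors of the tower are the level-`K` classes), 2026-08-20.
-/
import Summits.HodgeConjecture.HodgeCM.Model.TowerRes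
import Summits.HodgeConjecture.HodgeCM.Model.TowerTransfer
import Summits.HodgeConjecture.HodgeCM.Model.TowerAlgebra
import Summits.HodgeConjecture.HodgeCM.Literature.AlbaneseUnitaryShimuraModules

/-!
# `H^K = H_K`: the `K`-fixed vectors of the tower are exactly the image of the level-`K` carrier

For a level `Γ` below a conjugate of `K(3)` and `x ∈ H = lim_K H_K` (`Tower`, #R109):

* `TowerCarrier.mem_levelImage_iff` — `x ∈ levelImage Γ ↔ ∀ k ∈ Γ.K, k • x = x`;
* `TowerCarrier.fixedBy_eq_levelImage` — `fixedBy Γ.K H = levelImage Γ` (the dictionary's `fixedBy`, `Literature/AlbaneseUnitary…`).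

So the real-carrier dictionary `LiuDictionary.ofTower` (#R113) is honest about `H^K`: together with `res_ofLevel` (#R111) the subspace
`fixedBy Γ.K H` is `H_K = H¹(Sh_K(ℂ); ℂ)` (families over the components) and `res Γ` reads its identity component.

Proof (`mem_levelImage_of_fixed`).  Write `x = [c]`, `c ∈ H_{K'}`; shrink `K'` to the `K`-normal core `K'' = ⋂_{k ∈ K} k K' k⁻¹`
(`Level.kcore`, compact open: a finite intersection).  `K`-fixedness and injectivity of `H_{K''} → H` (#R111) give `k • c = c` in
`H_{K''}` for `k ∈ K`, i.e. componentwise `c_h = t_1^* c_{hk}`; combined with the family relation `c_h = t_γ^* c_{γ_f h}` this says that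
each `c_h` is invariant under the deck group `Γ_h / Γ''_h` of the normal cover `X_{Γ''_h} → X_{Γ_h}`, hence descends
(`TowerTransfer.exists_trPull_one_eq_of_invariant`, #R117) to `d_h ∈ H¹(X_{Γ_h})`; `d = (d_h)` is a family of level `K` (injectivity of
`t_1^*`, #R110) restricting to `c`.  Records: the universe's, `hA` ((ii-b)-free since the (iib-T) re-cut).
-/

noncomputable section

open scoped Matrix
open Matrix Function Set
open NumberField CategoryTheory
open Literature.AlgebraicGeometry.Motives
open Literature.AlgebraicGeometry.ShimuraVarieties
open Literature.AlgebraicGeometry.HodgeTheory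
open Literature.NumberTheory.Automorphic
open Literature.NumberTheory.Automorphic.PicardCM
open Literature.NumberTheory.Transcendental (Arapura2012_Cor_15_4_6)

/-! ## 1. The `K`-normal core level -/

namespace HodgeCM.Level

variable {L : CMField} {ι₁ : L →+* ℂ} {V : HermSpace3 L ι₁}

/-- `K' ∩ K` has finite index in `K` (open in compact). -/
theorem finiteIndex_subgroupOf_K (Γ Γ' : Level V) : (Γ'.K.subgroupOf Γ.K).FiniteIndex := by
  haveI : CompactSpace Γ.K := isCompact_iff_compactSpace.mp Γ.isCompact_K
  haveI : DiscreteTopology (Γ.K ⧸ Γ'.K.subgroupOf Γ.K) :=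
    QuotientGroup.discreteTopology (Γ'.isOpen_K.preimage continuous_subtype_val)
  haveI : Finite (Γ.K ⧸ Γ'.K.subgroupOf Γ.K) := finite_of_compact_of_discrete
  exact Subgroup.finiteIndex_of_finite_quotient

/-- **The `K`-normal core level** of `Γ'` with respect to `Γ`: `K'' = ⋂_{k ∈ Γ.K} k Γ'.K k⁻¹` (vendored `Subgroup.levelCore` over the
inclusion `Γ.K ≤ U(V)(𝔸_f)`), compact open (a finite intersection), `≤ Γ'.K`, normalised by `Γ.K`. -/
def kcore (Γ Γ' : Level V) : Level V where
  Γ := UnitaryGroup.arithmeticLevel (↥(maximalRealSubfield L)) L (IsCMField.complexConj L) 3 V.Hm (Subgroup.levelCore Γ.K.subtype Γ'.K)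
  K := Subgroup.levelCore Γ.K.subtype Γ'.K
  isCompact_K := by
    haveI : (Γ'.K.comap Γ.K.subtype).FiniteIndex := finiteIndex_subgroupOf_K Γ Γ'
    exact Subgroup.isCompact_levelCore _ _ Γ'.isCompact_K Γ'.isOpen_K
  isOpen_K := by
    haveI : (Γ'.K.comap Γ.K.subtype).FiniteIndex := finiteIndex_subgroupOf_K Γ Γ'
    exact Subgroup.isOpen_levelCore _ _ Γ'.isOpen_K
  arithmeticLevel_K := rfl
  torsionFree γ hγ hfin := by
    have hγ' : γ ∈ Γ'.Γ := by
      rw [← Γ'.arithmeticLevel_K]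
      exact UnitaryGroup.arithmeticLevel_mono (Subgroup.levelCore_le _ _) hγ
    exact Γ'.torsionFree γ hγ' hfin

/-- (Ported verbatim from the HodgeCMPerL package; no docstring in the source.) -/
theorem kcore_le (Γ Γ' : Level V) : kcore Γ Γ' ≤ Γ' := Subgroup.levelCore_le _ _

/-- `(kcore Γ Γ').K` is normalised by `Γ.K`. -/
theorem conj_mem_kcore_K (Γ Γ' : Level V) {k x : V.adelicFin} (hk : k ∈ Γ.K) (hx : x ∈ (kcore Γ Γ').K) :
    k * x * k⁻¹ ∈ (kcore Γ Γ').K :=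
  Subgroup.conj_mem_levelCore Γ.K.subtype Γ'.K hx ⟨k, hk⟩

/-- (Ported verbatim from the HodgeCMPerL package; no docstring in the source.) -/
theorem conjK_kcore_of_mem (Γ Γ' : Level V) {k : V.adelicFin} (hk : k ∈ Γ.K) : conjK (kcore Γ Γ').K k = (kcore Γ Γ').K := by
  ext x
  rw [mem_conjK_iff]
  constructor
  · rintro ⟨y, hy, rfl⟩
    exact conj_mem_kcore_K Γ Γ' hk hy
  · intro hx
    refine ⟨k⁻¹ * x * k, ?_, by group⟩
    have h := conj_mem_kcore_K Γ Γ' (Γ.K.inv_mem hk) hx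
    rwa [inv_inv] at h

/-- `(kcore Γ Γ').conj k = kcore Γ Γ'` for `k ∈ Γ.K`. -/
theorem kcore_conj_of_mem (Γ Γ' : Level V) {k : V.adelicFin} (hk : k ∈ Γ.K) (h3 : (kcore Γ Γ').BelowConjThree) :
    (kcore Γ Γ').conj k h3 = kcore Γ Γ' :=
  Level.ext (conjK_kcore_of_mem Γ Γ' hk)

/-- If `Γ'.K` is normalised by `Γ.K` then `Γ'.Γ` is normalised by `Γ.Γ`. -/
theorem conj_mem_Γ_of_conjK_le {Γ Γ' : Level V} (hK : ∀ k ∈ Γ.K, conjK Γ'.K k ≤ Γ'.K) {δ x : GL (Fin 3) L} (hδ : δ ∈ Γ.Γ)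
    (hx : x ∈ Γ'.Γ) : δ * x * δ⁻¹ ∈ Γ'.Γ := by
  obtain ⟨hxU, hxK⟩ := (mem_Γ_iff Γ').mp hx
  obtain ⟨hδU, hδK⟩ := (mem_Γ_iff Γ).mp hδ
  have hU : δ * x * δ⁻¹ ∈ UnitaryGroup.rational (↥(maximalRealSubfield L)) L (IsCMField.complexConj L) 3 V.Hm :=
    Subgroup.mul_mem _ (Subgroup.mul_mem _ hδU hxU) (Subgroup.inv_mem _ hδU)
  refine (mem_Γ_iff Γ').mpr ⟨hU, ?_⟩
  have e : (⟨δ * x * δ⁻¹, hU⟩ : UnitaryGroup.rational (↥(maximalRealSubfield L)) L (IsCMField.complexConj L) 3 V.Hm) =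
      ⟨δ, hδU⟩ * ⟨x, hxU⟩ * ⟨δ, hδU⟩⁻¹ := rfl
  rw [e, map_mul, map_mul, map_inv]
  exact hK _ hδK (mem_conjK_iff.mpr ⟨_, hxK, rfl⟩)

/-- … as a `Normal` instance of `Γ'.Γ ∩ Γ.Γ ⊴ Γ.Γ`. -/
theorem normal_subgroupOf_of_conjK_le {Γ Γ' : Level V} (hK : ∀ k ∈ Γ.K, conjK Γ'.K k ≤ Γ'.K) : (Γ'.Γ.subgroupOf Γ.Γ).Normal :=
  ⟨fun _ hx δ ↦ conj_mem_Γ_of_conjK_le hK δ.2 hx⟩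

/-- Normalisation passes to the conjugate levels: `(Γ'.conj h).K ⊴ (Γ.conj h).K`. -/
theorem conjK_conj_le_of_conjK_le {Γ Γ' : Level V} (hK : ∀ k ∈ Γ.K, conjK Γ'.K k ≤ Γ'.K) (h : V.adelicFin)
    (hΓ : Γ.BelowConjThree) (hΓ' : Γ'.BelowConjThree) :
    ∀ k' ∈ (Γ.conj h hΓ).K, conjK (Γ'.conj h hΓ').K k' ≤ (Γ'.conj h hΓ').K := by
  intro k' hk'
  obtain ⟨k, hk, rfl⟩ := (mem_conjK_iff (K := Γ.K)).mp hk'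
  rw [K_conj, ← conjK_mul, show h * k * h⁻¹ * h = h * k by group, conjK_mul]
  exact conjK_mono (hK k hk) h

end HodgeCM.Level

/-! ## 2. `K`-fixed vectors come from level `K` -/

namespace HodgeCM.Model.TowerCarrier

open HodgeCM.Model.LevelTranslate HodgeCM.Model.TowerLevel HodgeCM.Model.TowerInjective HodgeCM.Model.TowerTransfer
  HodgeCM.Literature.Theta

variable (hHD : exists_isReal_hodgeModel) (hI : hodgePQ_independent_of_hodgeModel)
  (hU : BallQuotientUniformisedDatum) (h₃ : CMAbelianVarietyRealised) (hA : Arapura2012_Cor_15_4_6)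
variable {L : CMField} {ι₁ : L →+* ℂ} {V : HermSpace3 L ι₁}

/-- **Descent for a `Γ.K`-normal sublevel.**  `Γ' ≤ Γ` with `Γ'.conj k = Γ'` for `k ∈ Γ.K`; if `[c] ∈ H` (`c ∈ H_{K'}`) is fixed by
`Γ.K` then `[c] ∈ levelImage Γ`. -/
theorem mem_levelImage_of_fixed_of_normal {Γ Γ' : Level V} (hle : Γ' ≤ Γ) (hΓ : Γ.BelowConjThree)
    (hΓ' : Γ'.BelowConjThree) (ek : ∀ k ∈ Γ.K, Γ'.conj k hΓ' = Γ') (c : towerLevel hHD hI hU h₃ hA Γ' hΓ')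
    (hx : ∀ k ∈ Γ.K, act hHD hI hU h₃ hA k (ofLevel hHD hI hU h₃ hA Γ' hΓ' c) = ofLevel hHD hI hU h₃ hA Γ' hΓ' c) :
    ofLevel hHD hI hU h₃ hA Γ' hΓ' c ∈ levelImage hHD hI hU h₃ hA Γ hΓ := by
  have hK : ∀ k ∈ Γ.K, Level.conjK Γ'.K k ≤ Γ'.K := fun k hk ↦ (congrArg Level.K (ek k hk)).le
  have hN : ∀ h : V.adelicFin, (((Γ'.conj h hΓ').Γ).subgroupOf ((Γ.conj h hΓ).Γ)).Normal := fun h ↦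
    Level.normal_subgroupOf_of_conjK_le (Level.conjK_conj_le_of_conjK_le hK h hΓ hΓ')
  -- (★★) `k • c = c` in `H_{K'}`
  have hcast : ∀ (k : V.adelicFin) (hk : k ∈ Γ.K),
      castLevel hHD hI hU h₃ hA (ek k hk) (hΓ'.conj k) hΓ' (TowerLevel.translate hHD hI hU h₃ hA hΓ' k c) = c := by
    intro k hk
    apply ofLevel_injective hHD hI hU h₃ hA Γ' hΓ'
    rw [ofLevel_castLevel, ← act_ofLevel]
    exact hx k hk
  -- componentwise: `c_h = t_1^* c_{h k}`
  have T3 : ∀ (h k : V.adelicFin), k ∈ Γ.K →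
      TransCond ((1 : ↥(Urat V)) : GL (Fin 3) L) (Γ'.conj h hΓ') (Γ'.conj (h * k) hΓ') :=
    fun h k hk ↦ (transCond_conj_of_le (ek k hk).symm.le (hΓ'.conj k) hΓ' h).one_trans (transCond_conj_conj hΓ' k h)
  have F : ∀ (h k : V.adelicFin) (hk : k ∈ Γ.K),
      c.1 h = trPull hHD hI hU h₃ hA 1 (Γ'.conj h hΓ') (Γ'.conj (h * k) hΓ') (T3 h k hk) 1 (c.1 (h * k)) := by
    intro h k hk
    have e1 : (castLevel hHD hI hU h₃ hA (ek k hk) (hΓ'.conj k) hΓ' (TowerLevel.translate hHD hI hU h₃ hA hΓ' k c)).1 h = c.1 h := by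
      rw [hcast k hk]
    rw [castLevel_apply, TowerLevel.translate_apply, trPull_trPull hHD hI hU h₃ hA (mul_one 1).symm _ _ (T3 h k hk) 1] at e1
    exact e1.symm
  -- each component is deck-invariant, hence descends to level `Γ.conj h`
  have hy : ∀ h : V.adelicFin, ∃ y : W hHD hI hU h₃ Γ hΓ h,
      trPull hHD hI hU h₃ hA 1 (Γ'.conj h hΓ') (Γ.conj h hΓ) (transCond_conj_of_le hle hΓ hΓ' h) 1 y = c.1 h := by
    intro h
    refine exists_trPull_one_eq_of_invariant hHD hI hU h₃ hA (Level.conj_mono hle h hΓ hΓ') (hN h) _ 1 _ fun γ hγ ↦ ?_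
    obtain ⟨hγU, k₀, hk₀, ek₀⟩ := (Level.mem_conj_Γ_iff Γ h hΓ).mp hγ
    set γᵤ : ↥(Urat V) := ⟨γ, (Γ.conj h hΓ).Γ_le_rational hγ⟩ with hγᵤ
    have eρ : ρ V γᵤ = h * k₀ * h⁻¹ := ek₀.symm
    have ei : ρ V γᵤ * h = h * k₀ := by rw [eρ, inv_mul_cancel_right]
    have r' : Rel Γ' γᵤ h (h * k₀) := ⟨1, Γ'.K.one_mem, by rw [mul_one, ei]⟩
    have Tself : TransCond ((γᵤ : ↥(Urat V)) : GL (Fin 3) L) (Γ'.conj h hΓ') (Γ'.conj h hΓ') :=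
      transCond_self_of_normal (hN h) (Level.conj_mono hle h hΓ hΓ') hγ
    calc trPull hHD hI hU h₃ hA γᵤ (Γ'.conj h hΓ') (Γ'.conj h hΓ') Tself 1 (c.1 h)
        = trPull hHD hI hU h₃ hA γᵤ (Γ'.conj h hΓ') (Γ'.conj h hΓ') Tself 1
            (trPull hHD hI hU h₃ hA 1 (Γ'.conj h hΓ') (Γ'.conj (h * k₀) hΓ') (T3 h k₀ hk₀) 1 (c.1 (h * k₀))) := by
          rw [← F h k₀ hk₀]
      _ = trPull hHD hI hU h₃ hA γᵤ (Γ'.conj h hΓ') (Γ'.conj (h * k₀) hΓ') (transCond_of_rel hΓ' r') 1 (c.1 (h * k₀)) :=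
          trPull_trPull hHD hI hU h₃ hA (one_mul γᵤ).symm Tself (T3 h k₀ hk₀) (transCond_of_rel hΓ' r') 1 _
      _ = c.1 h := (apply_eq_trPull hHD hI hU h₃ hA c r' (transCond_of_rel hΓ' r')).symm
  choose d hd using hy
  -- `d` is a family of level `K`
  have hdmem : d ∈ towerLevel hHD hI hU h₃ hA Γ hΓ := by
    refine (mem_towerLevel_iff hHD hI hU h₃ hA).mpr fun γ h h' r ↦ ?_
    obtain ⟨k, hk, rfl⟩ := r
    have TA : TransCond (γ : GL (Fin 3) L) (Γ'.conj h hΓ') (Γ.conj (ρ V γ * h * k) hΓ) :=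
      transCond_one_comp (transCond_conj_of_le hle hΓ hΓ' h) (transCond_of_rel hΓ (⟨k, hk, rfl⟩ : Rel Γ γ h (ρ V γ * h * k)))
    have TB : TransCond (γ : GL (Fin 3) L) (Γ'.conj h hΓ') (Γ'.conj (ρ V γ * h) hΓ') := transCond_of_rel hΓ' (Rel.self γ h)
    have TC : TransCond ((1 : ↥(Urat V)) : GL (Fin 3) L) (Γ'.conj (ρ V γ * h) hΓ') (Γ.conj (ρ V γ * h * k) hΓ) :=
      (T3 (ρ V γ * h) k hk).one_trans (transCond_conj_of_le hle hΓ hΓ' (ρ V γ * h * k))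
    apply trPull_one_injective hHD hI hU h₃ hA (transCond_conj_of_le hle hΓ hΓ' h) 1
    rw [hd h, trPull_trPull hHD hI hU h₃ hA (mul_one γ).symm _ _ TA 1, apply_eq_trPull hHD hI hU h₃ hA c (Rel.self γ h) TB,
      F (ρ V γ * h) k hk, ← hd (ρ V γ * h * k), trPull_trPull hHD hI hU h₃ hA (mul_one (1 : ↥(Urat V))).symm _ _ TC 1,
      trPull_trPull hHD hI hU h₃ hA (one_mul γ).symm _ _ TA 1]
  refine ⟨⟨d, hdmem⟩, ?_⟩
  rw [← ofLevel_restrictLevel hHD hI hU h₃ hA hle hΓ hΓ' ⟨d, hdmem⟩]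
  congr 1
  apply Subtype.ext
  funext h
  rw [restrictLevel_apply]
  exact hd h

/-- **`K`-fixed vectors of the tower come from level `K`.** -/
theorem mem_levelImage_of_fixed (Γ : Level V) (hΓ : Γ.BelowConjThree)
    {x : Tower hHD hI hU h₃ hA V} (hx : ∀ k ∈ Γ.K, act hHD hI hU h₃ hA k x = x) :
    x ∈ levelImage hHD hI hU h₃ hA Γ hΓ := by
  obtain ⟨Γ₁, hΓ₁, c₁, rfl⟩ := exists_ofLevel hHD hI hU h₃ hA x
  have hΓ' : (Level.kcore Γ (Γ₁ ⊓ Γ)).BelowConjThree := (hΓ.of_le inf_le_right).of_le (Level.kcore_le _ _)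
  have hle : Level.kcore Γ (Γ₁ ⊓ Γ) ≤ Γ := (Level.kcore_le _ _).trans inf_le_right
  have hle₁ : Level.kcore Γ (Γ₁ ⊓ Γ) ≤ Γ₁ := (Level.kcore_le _ _).trans inf_le_left
  obtain ⟨c, hc⟩ := levelImage_mono hHD hI hU h₃ hA hle₁ hΓ₁ hΓ' (ofLevel_mem_levelImage hHD hI hU h₃ hA Γ₁ hΓ₁ c₁)
  rw [← hc] at hx ⊢
  exact mem_levelImage_of_fixed_of_normal hHD hI hU h₃ hA hle hΓ hΓ' (fun k hk ↦ Level.kcore_conj_of_mem Γ _ hk hΓ') c hx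

/-- **`H^K = H_K`**: `x ∈ levelImage Γ ↔ k • x = x` for all `k ∈ Γ.K`. -/
theorem mem_levelImage_iff (Γ : Level V) (hΓ : Γ.BelowConjThree) {x : Tower hHD hI hU h₃ hA V} :
    x ∈ levelImage hHD hI hU h₃ hA Γ hΓ ↔ ∀ k ∈ Γ.K, act hHD hI hU h₃ hA k x = x := by
  refine ⟨?_, mem_levelImage_of_fixed hHD hI hU h₃ hA Γ hΓ⟩
  rintro ⟨c, rfl⟩ k hk
  exact act_ofLevel_of_mem hHD hI hU h₃ hA hΓ hk c

/-! ## 3. In the dictionary's language: `fixedBy Γ.K H = levelImage Γ` -/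

/-- **`fixedBy Γ.K H = H_K`** for the `ℂ[U(V)(𝔸_f)]`-module `H = Tower` (#R112) and the dictionary's `fixedBy`. -/
theorem fixedBy_eq_levelImage (Γ : Level V) (hΓ : Γ.BelowConjThree) :
    fixedBy Γ.K (Tower hHD hI hU h₃ hA V) = levelImage hHD hI hU h₃ hA Γ hΓ := by
  ext x
  rw [mem_fixedBy, mem_levelImage_iff hHD hI hU h₃ hA Γ hΓ]
  simp only [of_smul_eq_act]

end HodgeCM.Model.TowerCarrier

end
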